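import Mathlib
import Literature.Algebra.Polynomial.DescartesSignVariations
import Summits.ValiantsHypothesis.ValiantsHypothesis.Theorems.LacunarySymmetroidMatrixDescartesInertiaCertificate

/-!
# `MatrixDescartes` (stmt-ValiantsHypothesis-18050) — INERTIA KIT, IV: THE PARITY LAW OF THE INERTIA WALK — across a gap the
# negative index changes by the number of roots of `det F` counted with multiplicity, MODULO TWO; simple roots move the index
# by exactly one, corank-one roots of even multiplicity do not move it

HONEST FRAMING.  Cell `pub-symmetroid`, seat `val-sym-mdr-p2` (gen 16); helper file `--supports` the crux
`Theses.LacunarySymmetroid.MatrixDescartes`, NO closure claim.  General facts about every real-symmetric lacunary pencil at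
every format, completing the inertia-walk instrument (`…InertiaCertificate`: `|Δν| ≤ #roots with multiplicity`) by the
congruence `Δν ≡ #roots with multiplicity (mod 2)`; nothing here bears on the crux in its window, on `stub_twoSided`, on
`DoorA26`/`DoorA34`, registers, or `VP ≠ VNP`.

CONTENT.  (§1) `neg_one_pow_negIndex_mul_det_pos`: for a non-singular real symmetric `A`, `sign det A = (−1)^{ν(A)}`
(`det = ∏ λⱼ`).  (§2) `neg_one_pow_card_roots_mul_eval_mul_eval_pos`: for a real polynomial `f` with `f(a)f(b) ≠ 0`, `a ≤ b`,
`sign (f(a)f(b)) = (−1)^{#roots in (a,b) with multiplicity}` (induction on the roots; base = the tree's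
`Descartes.mul_eval_pos_of_forall_ne_zero`).  (§3) `even_negIndex_add_negIndex_add_card_roots` — THE PARITY LAW:
`ν(F(a)) + ν(F(b)) + #{roots of det F in (a,b), with multiplicity}` is even whenever `F(a)`, `F(b)` are non-singular.
(§4) Consequences per gap containing a single root `z`: `|ν(F(b)) − ν(F(a))| ≤ dim ker F(z)` and `≡ mult_z (mod 2)`; a SIMPLE
root moves the index by EXACTLY one (`dist_negIndex_eq_one_of_simple_root`); a corank-one root of EVEN multiplicity (a
touching, tangential crossing) does not move it (`negIndex_eq_of_even_mult_corank_one`). [folklore]; axioms standard; no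
definitions.
-/

-- layout Summits/ValiantsHypothesis/ValiantsHypothesis forces the duplicated namespace component
set_option linter.dupNamespace false

namespace Summit.ValiantsHypothesis.ValiantsHypothesis.Theorems.LacunarySymmetroidMatrixDescartes

open Polynomial Matrix Finset
open scoped BigOperators Topology

namespace Inertia

variable {ι : Type} [Fintype ι] [DecidableEq ι]

/-! ## §1 The sign of the determinant is `(−1)^ν` -/

/-- **`sign det A = (−1)^{ν(A)}`** for a non-singular real symmetric (hermitian) matrix. [folklore] -/
theorem neg_one_pow_negIndex_mul_det_pos {A : Matrix ι ι ℝ} (hA : A.IsHermitian) (hdet : A.det ≠ 0) :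
    0 < (-1 : ℝ) ^ Fintype.card {j // hA.eigenvalues j < 0} * A.det := by
  classical
  have hprod : A.det = ∏ i, hA.eigenvalues i := by rw [hA.det_eq_prod_eigenvalues]; simp
  have hne : ∀ i, hA.eigenvalues i ≠ 0 := by
    intro i h0
    apply hdet
    rw [hprod]
    exact Finset.prod_eq_zero (Finset.mem_univ i) h0
  -- split the eigenvalues into negative and positive ones
  set s := Finset.univ.filter (fun i => hA.eigenvalues i < 0) with hs
  have hcard : Fintype.card {j // hA.eigenvalues j < 0} = s.card := Fintype.card_subtype _
  have hsplit : ∏ i, hA.eigenvalues i = (∏ i ∈ s, hA.eigenvalues i) * ∏ i ∈ Finset.univ.filter (fun i => ¬ hA.eigenvalues i < 0),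
      hA.eigenvalues i := (Finset.prod_filter_mul_prod_filter_not _ _ _).symm
  have hneg : (-1 : ℝ) ^ s.card * ∏ i ∈ s, hA.eigenvalues i = ∏ i ∈ s, (-hA.eigenvalues i) := by
    rw [Finset.prod_neg]
  have hpos1 : 0 < ∏ i ∈ s, (-hA.eigenvalues i) :=
    Finset.prod_pos fun i hi => neg_pos.2 (Finset.mem_filter.1 hi).2
  have hpos2 : 0 < ∏ i ∈ Finset.univ.filter (fun i => ¬ hA.eigenvalues i < 0), hA.eigenvalues i :=
    Finset.prod_pos fun i hi => lt_of_le_of_ne (not_lt.1 (Finset.mem_filter.1 hi).2) (hne i).symm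
  rw [hcard, hprod, hsplit, ← mul_assoc, hneg]
  exact mul_pos hpos1 hpos2

/-! ## §2 The sign of a polynomial across its roots -/

omit [Fintype ι] [DecidableEq ι] in
/-- **`sign (f(a)·f(b)) = (−1)^{#roots in (a,b) with multiplicity}`** for a real polynomial non-vanishing at `a ≤ b`.
[folklore] -/
theorem neg_one_pow_card_roots_mul_eval_mul_eval_pos :
    ∀ (n : ℕ) (f : ℝ[X]) {a b : ℝ}, a ≤ b → f.eval a ≠ 0 → f.eval b ≠ 0 →
      Multiset.card (f.roots.filter (fun t => a < t ∧ t < b)) = n →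
      0 < (-1 : ℝ) ^ n * (f.eval a * f.eval b) := by
  intro n
  induction n using Nat.strong_induction_on with
  | _ n ih =>
    intro f a b hab ha hb hn
    have hf : f ≠ 0 := fun h => ha (by rw [h, eval_zero])
    by_cases h0 : n = 0
    · -- no root in `(a, b)`, none at the ends: one sign on `[a, b]`
      subst h0
      rw [pow_zero, one_mul]
      refine Literature.Algebra.Polynomial.Descartes.mul_eval_pos_of_forall_ne_zero hab fun z hz hz0 => ?_
      rcases eq_or_lt_of_le hz.1 with rfl | haz
      · exact ha hz0
      rcases eq_or_lt_of_le hz.2 with rfl | hzb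
      · exact hb hz0
      have hmem : z ∈ f.roots.filter (fun t => a < t ∧ t < b) :=
        Multiset.mem_filter.2 ⟨(mem_roots hf).2 hz0, haz, hzb⟩
      rw [Multiset.card_eq_zero.1 hn] at hmem
      exact Multiset.notMem_zero _ hmem
    · -- pick a root `z` in the gap and factor `f = (X − z)^μ · g`
      obtain ⟨z, hz⟩ := Multiset.card_pos_iff_exists_mem.1 (by omega : 0 < Multiset.card (f.roots.filter
        (fun t => a < t ∧ t < b)))
      obtain ⟨hzr, haz, hzb⟩ := Multiset.mem_filter.1 hz
      have hfac := pow_mul_divByMonic_rootMultiplicity_eq f z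
      set μ := f.rootMultiplicity z with hμ
      set g := f /ₘ (X - C z) ^ μ with hg
      have hgz : g.eval z ≠ 0 := eval_divByMonic_pow_rootMultiplicity_ne_zero z hf
      have hg0 : g ≠ 0 := fun h => hgz (by rw [h, eval_zero])
      have hμ0 : 0 < μ := (rootMultiplicity_pos hf).2 ((mem_roots hf).1 hzr)
      have hevf : ∀ t, f.eval t = (t - z) ^ μ * g.eval t := fun t => by
        rw [← hfac]; simp
      have hga : g.eval a ≠ 0 := fun h => ha (by rw [hevf, h, mul_zero])
      have hgb : g.eval b ≠ 0 := fun h => hb (by rw [hevf, h, mul_zero])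
      -- the roots of `g` in the gap are those of `f` minus `μ` copies of `z`
      have hroots : f.roots.filter (fun t => a < t ∧ t < b)
          = μ • {z} + g.roots.filter (fun t => a < t ∧ t < b) := by
        conv_lhs => rw [← hfac]
        rw [roots_mul (hfac.symm ▸ hf), roots_pow, roots_X_sub_C, Multiset.filter_add, Multiset.filter_nsmul,
          Multiset.filter_singleton, if_pos ⟨haz, hzb⟩]
      have hcardg : Multiset.card (g.roots.filter (fun t => a < t ∧ t < b)) = n - μ := by
        have h := congrArg Multiset.card hroots
        rw [Multiset.card_add, Multiset.card_nsmul, Multiset.card_singleton, mul_one, hn] at h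
        omega
      have hlt : n - μ < n := by omega
      have hih := ih (n - μ) hlt g hab hga hgb hcardg
      have hμle : μ ≤ n := by
        have h := congrArg Multiset.card hroots
        rw [Multiset.card_add, Multiset.card_nsmul, Multiset.card_singleton, mul_one, hn] at h
        omega
      -- signs: `((a − z)(b − z))^μ` has sign `(−1)^μ`
      have hprodneg : 0 < (-1 : ℝ) ^ μ * ((a - z) ^ μ * (b - z) ^ μ) := by
        rw [← mul_pow, ← mul_pow]
        exact pow_pos (by nlinarith) μ
      have e : (-1 : ℝ) ^ n * (f.eval a * f.eval b)
          = ((-1 : ℝ) ^ μ * ((a - z) ^ μ * (b - z) ^ μ)) * ((-1 : ℝ) ^ (n - μ) * (g.eval a * g.eval b)) := by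
        rw [hevf a, hevf b, show (-1 : ℝ) ^ n = (-1) ^ μ * (-1) ^ (n - μ) by rw [← pow_add]; congr 1; omega]
        ring
      rw [e]
      exact mul_pos hprodneg hih

/-! ## §3 The parity law -/

section Pencil

variable {κ : Type} [Fintype κ]

/-- **THE PARITY LAW OF THE INERTIA WALK.**  `F(X) = ∑ₖ X^{dₖ} Sₖ` with real symmetric letters, `a ≤ b`, `F(a)` and `F(b)`
non-singular.  Then `ν(F(a)) + ν(F(b)) + #{roots of det F in (a,b), counted with multiplicity}` is EVEN: the index moves by
the root count modulo two. [folklore] -/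
theorem even_negIndex_add_negIndex_add_card_roots (d : κ → ℕ) (S : κ → Matrix ι ι ℝ) (hS : ∀ k, (S k).IsSymm)
    {a b : ℝ} (hab : a ≤ b) (ha : (∑ k, a ^ d k • S k).det ≠ 0) (hb : (∑ k, b ^ d k • S k).det ≠ 0) :
    Even (Fintype.card {j // (isHermitian_pencil d S hS a).eigenvalues j < 0}
      + Fintype.card {j // (isHermitian_pencil d S hS b).eigenvalues j < 0}
      + Multiset.card ((Matrix.det (∑ k, ((X : ℝ[X]) ^ d k) • (S k).map C)).roots.filter (fun t => a < t ∧ t < b))) := by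
  classical
  set P := Matrix.det (∑ k, ((X : ℝ[X]) ^ d k) • (S k).map C) with hP
  set νa := Fintype.card {j // (isHermitian_pencil d S hS a).eigenvalues j < 0} with hνa
  set νb := Fintype.card {j // (isHermitian_pencil d S hS b).eigenvalues j < 0} with hνb
  set N := Multiset.card (P.roots.filter (fun t => a < t ∧ t < b)) with hN
  have hPa : P.eval a = (∑ k, a ^ d k • S k).det := DefiniteMoments.eval_det_pencil d S a
  have hPb : P.eval b = (∑ k, b ^ d k • S k).det := DefiniteMoments.eval_det_pencil d S b
  have h1 := neg_one_pow_negIndex_mul_det_pos (isHermitian_pencil d S hS a) ha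
  have h2 := neg_one_pow_negIndex_mul_det_pos (isHermitian_pencil d S hS b) hb
  have h3 := neg_one_pow_card_roots_mul_eval_mul_eval_pos N P hab (by rw [hPa]; exact ha) (by rw [hPb]; exact hb) rfl
  rw [hPa, hPb] at h3
  have hprod : 0 < (-1 : ℝ) ^ (νa + νb + N) * ((∑ k, a ^ d k • S k).det * (∑ k, b ^ d k • S k).det) ^ 2 := by
    have e : (-1 : ℝ) ^ (νa + νb + N) * ((∑ k, a ^ d k • S k).det * (∑ k, b ^ d k • S k).det) ^ 2
        = ((-1 : ℝ) ^ νa * (∑ k, a ^ d k • S k).det) * ((-1 : ℝ) ^ νb * (∑ k, b ^ d k • S k).det)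
          * ((-1 : ℝ) ^ N * ((∑ k, a ^ d k • S k).det * (∑ k, b ^ d k • S k).det)) := by
      rw [pow_add, pow_add]; ring
    rw [e]
    exact mul_pos (mul_pos h1 h2) h3
  rcases Nat.even_or_odd (νa + νb + N) with h | h
  · exact h
  · exfalso
    rw [h.neg_one_pow] at hprod
    have : 0 ≤ ((∑ k, a ^ d k • S k).det * (∑ k, b ^ d k • S k).det) ^ 2 := sq_nonneg _
    linarith

/-! ## §4 One root in a gap -/

/-- **One root in the gap.**  If `z` is the only root of `det F` in `(a, b)` (`a < z < b`, ends non-singular), then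
(i) the roots in the gap counted with multiplicity are `mult_z det F`; (ii) `|ν(F(b)) − ν(F(a))| ≤ dim ker F(z)`;
(iii) `ν(F(a)) + ν(F(b)) + mult_z det F` is even. [folklore] -/
theorem single_root_gap (d : κ → ℕ) (S : κ → Matrix ι ι ℝ) (hS : ∀ k, (S k).IsSymm)
    (hdet : Matrix.det (∑ k, ((X : ℝ[X]) ^ d k) • (S k).map C) ≠ 0) {a z b : ℝ} (haz : a < z) (hzb : z < b)
    (ha : (∑ k, a ^ d k • S k).det ≠ 0) (hb : (∑ k, b ^ d k • S k).det ≠ 0)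
    (honly : ∀ t : ℝ, a < t → t < b → (∑ k, t ^ d k • S k).det = 0 → t = z) :
    Multiset.card ((Matrix.det (∑ k, ((X : ℝ[X]) ^ d k) • (S k).map C)).roots.filter (fun t => a < t ∧ t < b))
        = (Matrix.det (∑ k, ((X : ℝ[X]) ^ d k) • (S k).map C)).rootMultiplicity z ∧
      Nat.dist (Fintype.card {j // (isHermitian_pencil d S hS b).eigenvalues j < 0})
          (Fintype.card {j // (isHermitian_pencil d S hS a).eigenvalues j < 0})
        ≤ Fintype.card ι - (∑ k, z ^ d k • S k).rank ∧
      Even (Fintype.card {j // (isHermitian_pencil d S hS a).eigenvalues j < 0}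
        + Fintype.card {j // (isHermitian_pencil d S hS b).eigenvalues j < 0}
        + (Matrix.det (∑ k, ((X : ℝ[X]) ^ d k) • (S k).map C)).rootMultiplicity z) := by
  classical
  set P := Matrix.det (∑ k, ((X : ℝ[X]) ^ d k) • (S k).map C) with hP
  set M := P.roots.filter (fun t => a < t ∧ t < b) with hM
  -- (i) every root in the gap is `z`
  have hall : ∀ t ∈ M, t = z := by
    intro t ht
    obtain ⟨htr, h1, h2⟩ := Multiset.mem_filter.1 ht
    exact honly t h1 h2 (by rw [← DefiniteMoments.eval_det_pencil]; exact (mem_roots hdet).1 htr)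
  have hrep : M = Multiset.replicate (Multiset.card M) z := Multiset.eq_replicate_card.2 hall
  have hcnt : M.count z = Multiset.card M := by
    conv_lhs => rw [hrep]
    exact Multiset.count_replicate_self _ _
  have hcardM : Multiset.card M = P.rootMultiplicity z := by
    rw [← hcnt, hM, Multiset.count_filter_of_pos (p := fun t => a < t ∧ t < b) ⟨haz, hzb⟩, count_roots]
  -- (ii) the two-sided window inequality with `T = {z}`
  have hT : ∀ x ∈ Set.Icc a b, ((fun x : ℝ => ∑ k, x ^ d k • S k) x).det = 0 → x ∈ ({z} : Finset ℝ) := by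
    intro x hx hx0
    rw [Finset.mem_singleton]
    rcases eq_or_lt_of_le hx.1 with rfl | hax
    · exact absurd hx0 ha
    rcases eq_or_lt_of_le hx.2 with rfl | hxb
    · exact absurd hx0 hb
    exact honly x hax hxb hx0
  have hwin := negIndex_dist_le_sum_corank (fun x => ∑ k, x ^ d k • S k) (continuous_pencil_entry d S)
    (isHermitian_pencil d S hS) {z} (le_of_lt (lt_trans haz hzb)) hT ha hb
  have hsum : ∑ t ∈ ({z} : Finset ℝ).filter (fun t => a < t ∧ t < b),
      (Fintype.card ι - ((fun x : ℝ => ∑ k, x ^ d k • S k) t).rank) = Fintype.card ι - (∑ k, z ^ d k • S k).rank := by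
    rw [Finset.filter_singleton, if_pos ⟨haz, hzb⟩, Finset.sum_singleton]
  rw [hsum] at hwin
  -- (iii) parity
  have heven := even_negIndex_add_negIndex_add_card_roots d S hS (le_of_lt (lt_trans haz hzb)) ha hb
  rw [← hP, ← hM, hcardM] at heven
  refine ⟨hcardM, ?_, heven⟩
  unfold Nat.dist
  omega

/-- **A simple root moves the index by exactly one.** [folklore] -/
theorem dist_negIndex_eq_one_of_simple_root (d : κ → ℕ) (S : κ → Matrix ι ι ℝ) (hS : ∀ k, (S k).IsSymm)
    (hdet : Matrix.det (∑ k, ((X : ℝ[X]) ^ d k) • (S k).map C) ≠ 0) {a z b : ℝ} (haz : a < z) (hzb : z < b)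
    (ha : (∑ k, a ^ d k • S k).det ≠ 0) (hb : (∑ k, b ^ d k • S k).det ≠ 0)
    (honly : ∀ t : ℝ, a < t → t < b → (∑ k, t ^ d k • S k).det = 0 → t = z)
    (hsimple : (Matrix.det (∑ k, ((X : ℝ[X]) ^ d k) • (S k).map C)).rootMultiplicity z = 1) :
    Nat.dist (Fintype.card {j // (isHermitian_pencil d S hS b).eigenvalues j < 0})
        (Fintype.card {j // (isHermitian_pencil d S hS a).eigenvalues j < 0}) = 1 := by
  obtain ⟨-, hdist, heven⟩ := single_root_gap d S hS hdet haz hzb ha hb honly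
  rw [hsimple] at heven
  -- corank ≤ multiplicity = 1
  have hcorank : Fintype.card ι - (∑ k, z ^ d k • S k).rank ≤ 1 := by
    rw [← hsimple]
    refine Multiplicity.le_rootMultiplicity_det_pencil_of_rank d S hdet z _ ?_
    have := Matrix.rank_le_card_width (∑ k, z ^ d k • S k)
    omega
  obtain ⟨r, hr⟩ := heven
  unfold Nat.dist at hdist ⊢
  omega

/-- **A corank-one root of even multiplicity (a touching crossing) does not move the index.** [folklore] -/
theorem negIndex_eq_of_even_mult_corank_one (d : κ → ℕ) (S : κ → Matrix ι ι ℝ) (hS : ∀ k, (S k).IsSymm)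
    (hdet : Matrix.det (∑ k, ((X : ℝ[X]) ^ d k) • (S k).map C) ≠ 0) {a z b : ℝ} (haz : a < z) (hzb : z < b)
    (ha : (∑ k, a ^ d k • S k).det ≠ 0) (hb : (∑ k, b ^ d k • S k).det ≠ 0)
    (honly : ∀ t : ℝ, a < t → t < b → (∑ k, t ^ d k • S k).det = 0 → t = z)
    (hrank : (∑ k, z ^ d k • S k).rank + 1 = Fintype.card ι)
    (heven : Even ((Matrix.det (∑ k, ((X : ℝ[X]) ^ d k) • (S k).map C)).rootMultiplicity z)) :
    Fintype.card {j // (isHermitian_pencil d S hS b).eigenvalues j < 0}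
      = Fintype.card {j // (isHermitian_pencil d S hS a).eigenvalues j < 0} := by
  obtain ⟨-, hdist, hev⟩ := single_root_gap d S hS hdet haz hzb ha hb honly
  obtain ⟨r, hr⟩ := heven
  obtain ⟨r', hr'⟩ := hev
  unfold Nat.dist at hdist
  omega

end Pencil

end Inertia

end Summit.ValiantsHypothesis.ValiantsHypothesis.Theorems.LacunarySymmetroidMatrixDescartes
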